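import Summits.HubbardSuperconductivity.HubbardSuperconductivity.Theorems.NodalWardXYNodalReductionOfOrderWindow
import Summits.HubbardSuperconductivity.HubbardSuperconductivity.Theorems.NodalWardXYNodalReductionTrialStateBound
import Summits.HubbardSuperconductivity.HubbardSuperconductivity.Theorems.NodalWardXYNodalReductionDoubleCommutatorForm
import Summits.HubbardSuperconductivity.HubbardSuperconductivity.Theorems.NodalWardXYNodalReductionOrderSqLower
import Summits.HubbardSuperconductivity.HubbardSuperconductivity.Theorems.NodalWardXYNodalReductionSelectionRules
import Summits.HubbardSuperconductivity.HubbardSuperconductivity.Theorems.NodalWardXYNodalReductionGoodGroundVector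
import Summits.HubbardSuperconductivity.HubbardSuperconductivity.Theorems.NodalWardXYNodalReductionKTBridge

/-!
# Line `Sketch` — skeleton for crux `NodalWardXY.NodalReduction` (stmt-HubbardSuperconductivity-1268)

Rev c10 (lead seat c10-0, 2026-08-17): the zero-field Koma–Tasaki bridge line, RESHAPED at the skeleton level.

Vocabulary (named `Prop`s) = `Theorems/NodalWardXYNodalReductionDefs.lean` (landed p85591), namespace
`Summit.HubbardSuperconductivity.HubbardSuperconductivity.Theorems.NodalReduction`; closing edges =
`Theorems/NodalWardXYNodalReductionOfOrderWindow.lean` (landed p96085).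

What is PROVED (all landed, `--supports stmt-HubbardSuperconductivity-1268`):
* (A) `stub_trialStateBound` p86961, (B) `stub_doubleCommutatorForm` p89390, (C) `stub_orderSqLower` p89970,
  (D) `stub_selectionRules` p90447, (E) `stub_goodGroundVector` p91211, (F) `stub_ktBridge_of` p91685, hence
  `ktBridge : KTBridge` (p91948): a zero-field torus plateau `a(L+1)⁴ ≤ Re ω₀(Δ_dᴴΔ_d)` forces
  `√(a/2) ≤ dWaveOrderParameter U μ`;
* the compositions `nodalReduction_of_zeroField : KTBridge → ZeroFieldTarget → NodalReduction` (Defs) and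
  `nodalReduction_of_{window,orderFloor,bcsConstruction,plateauWindow}` (p96085).

RESHAPE (why). The rev-1 open stub (Z) `stub_zeroFieldTarget : ZeroFieldTarget` asks for a zero-field pair-LRO
PLATEAU of the tracial grand-canonical ground state at one doping for all `U < U₀` — strictly STRONGER than the
crux's order clause `HasDWaveOrder U μ` (plateau ⇒ SSB is the proved bridge; SSB ⇒ plateau is Koma–Tasaki's open
converse, crux stmt-HubbardSuperconductivity-2009) and not supplied by any item in the tree. The weakest statement
that still closes the crux through a LANDED edge and that an EXISTING item supplies is the body of the sibling crux
`WeakCouplingBCS.WcbcsBcsConstruction` (stmt-HubbardSuperconductivity-2010), consumed verbatim by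
`nodalReduction_of_bcsConstruction`. Rev c10 therefore registers exactly ONE stub, (Z′) below, whose signature is
token for token the signature of stmt-HubbardSuperconductivity-2010: `stub-landed (Z′)` ⟺ stmt-2010 proved.
The plateau currency (Z) stays available as the alternative closure `NodalReduction_of_plateau` (hypothesis-taking,
sorry-free) for a promoted plateau item.

Sorries live only in `stub_*`.
-/

noncomputable section

-- `Summit.HubbardSuperconductivity.HubbardSuperconductivity.…` is the tree's summit/sub-problem namespace (D-0017).
set_option linter.dupNamespace false

namespace Summit.HubbardSuperconductivity.HubbardSuperconductivity.Cruxes.NodalReduction.LineSketch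

open Summit.HubbardSuperconductivity.HubbardSuperconductivity.Theses.NodalWardXY
open Summit.HubbardSuperconductivity.HubbardSuperconductivity.Theorems.NodalReduction
open scoped Matrix

/-! ## The one open stub -/

/-- Stub (Z′): the weak-coupling d-wave (BCS/Kohn–Luttinger) construction — word for word the body of the sibling
crux `WeakCouplingBCS.WcbcsBcsConstruction` (stmt-HubbardSuperconductivity-2010): one doping `δ ∈ (0,1/2)`, a
window `U ∈ (0,U₀)`, for each such `U` a chemical potential `μ` whose grand-canonical tracial ground-state density
on the `(L+1)×(L+1)` torus tends to `1 − δ`, and the BCS floor `e^{−C/U²} ≤ dWaveOrderParameter U μ`.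
This IS stmt-2010 (upstream half "UpstreamGapScale" of the crux's informal proof plan included); it is not
claimed provable inside this line — it is the named existing item the crux is parked on. -/
theorem stub_wcbcsBcsConstruction :
    ∃ δ ∈ Set.Ioo (0:ℝ) (1 / 2), ∃ U₀ : ℝ, 0 < U₀ ∧ ∃ C : ℝ, 0 < C ∧ ∀ U ∈ Set.Ioo (0:ℝ) U₀, ∃ μ : ℝ,
      Filter.Tendsto (fun L : ℕ =>
        ((Literature.MathematicalPhysics.QuantumLattice.hubbardTorusWith 2 (L + 1) 1 U μ).groundStateFunctional
          Literature.MathematicalPhysics.QuantumLattice.totalNumber).re / ((L + 1 : ℕ) : ℝ) ^ 2)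
        Filter.atTop (nhds (1 - δ)) ∧
      Real.exp (-C / U ^ 2) ≤ Literature.MathematicalPhysics.QuantumLattice.dWaveOrderParameter U μ := by
  sorry

/-! ## Landed content of the line (sorry-free) -/

/-- **The Koma–Tasaki bridge for the Hubbard torus, PROVED** (stubs A–F landed; the same term as
`Theorems.NodalReduction.ktBridge`, re-assembled here so the line's own stubs stay visible). -/
theorem ktBridge' : KTBridge :=
  stub_ktBridge_of stub_trialStateBound stub_doubleCommutatorForm stub_orderSqLower stub_selectionRules
    stub_goodGroundVector

/-- **Alternative closure in the XY engine's currency** (rev-1 stub (Z) turned into a hypothesis): a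
density-matched zero-field plateau window, if ever supplied by a promoted item, closes the crux through the
proved bridge. Sorry-free; not a stub. -/
theorem NodalReduction_of_plateau
    (hZ : PerturbedXYOrder →
      ∃ δ ∈ Set.Ioo (0:ℝ) (1/2), ∃ U₀ : ℝ, 0 < U₀ ∧ ∀ U ∈ Set.Ioo (0:ℝ) U₀, ∃ μ : ℝ,
        Filter.Tendsto (fun L : ℕ =>
          ((Literature.MathematicalPhysics.QuantumLattice.hubbardTorusWith 2 (L + 1) 1 U μ).groundStateFunctional
            Literature.MathematicalPhysics.QuantumLattice.totalNumber).re / ((L + 1 : ℕ) : ℝ) ^ 2)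
          Filter.atTop (nhds (1 - δ)) ∧
        ∃ a : ℝ, 0 < a ∧ ∀ᶠ L : ℕ in Filter.atTop, a * (((L + 1 : ℕ) : ℝ)) ^ 4 ≤
          ((Literature.MathematicalPhysics.QuantumLattice.hubbardTorusWith 2 (L + 1) 1 U μ).groundStateFunctional
            ((Literature.MathematicalPhysics.QuantumLattice.pairField
                Literature.MathematicalPhysics.QuantumLattice.dWaveFormFactor (L + 1))ᴴ *
              Literature.MathematicalPhysics.QuantumLattice.pairField
                Literature.MathematicalPhysics.QuantumLattice.dWaveFormFactor (L + 1))).re) :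
    NodalReduction :=
  nodalReduction_of_zeroField ktBridge' (fun _ hP => hZ hP)

/-! ## Composition -/

/-- **The crux, modulo the one stub** (by name): stmt-2010's body ⇒ an order floor `e^{−C/U²} > 0` ⇒ the window ⇒
`NodalReduction` (landed edge `nodalReduction_of_bcsConstruction`, p96085). -/
theorem NodalReduction_of : NodalReduction :=
  nodalReduction_of_bcsConstruction stub_wcbcsBcsConstruction

end Summit.HubbardSuperconductivity.HubbardSuperconductivity.Cruxes.NodalReduction.LineSketch

end
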